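import Summits.BirchSwinnertonDyer.BirchSwinnertonDyer.Theorems.ByReductionTypeAtTwoSupersingularFlatHondaLogCharSum
import HarnessLib

/-!
# Crux `SupersingularRankZeroAtTwo` (K4, item stmt-BirchSwinnertonDyer-19097), line `odd_blind_package` v2.19, `stub_flatPackage`
# conjunct (8), F3 — FILE E1c: the BASE-CASE LOGARITHMS (`n = 0, 1`) of the Sprung–Honda point at `2` for a general `a₂`:
# `Λ(T⁻¹ d_0) = −2N(1+a) + 4 = 2(a²−2a−1)` and `Λ(T⁻¹ d_1) + Λ(T⁻¹(g₀•d_1)) = −2Na(1+a) + 8 = 2(a³−2a²−3a+4)` (`N = 3 − a`)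

Seat `bsd-2adic-tower-1` GEN 69, hand «hF3-ERL» (pen GEN 41 SUMMON 20260831T215831Z, director-bsd (979) slot 2). HONEST FRAMING:
theorems only (no definition, no named fact, no instance, no `sorry`); local Galois bookkeeping at `2` on the displayed data of
`SSHondaTwo.sprungPrimal_padic_withLog`; helper toward conjunct (8) F3 of `stub_flatPackage` — the input `hlog` (`Σ_{j<2ⁿ} L_j = ℓ₀ = 2h₀`)
of `SSFlatERL.flat_level_identity_trivial` for THE system; closes no stub and no item; 19097 OPEN; BSD₂ is proved for no supersingular curve and
BSD for no curve by any of this. The `a₂ = 0` twin is K3's `LocalVar.*` in `…PlusHondaLogBaseCases` (`−2`, `8`).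

## What (Sprung data: `x 0 = 1`, `2x_1 = a`, `2x_2 = a x_1 − x_0`; `ℓ_m(x) = ∑_{k<m} x_k(ζ_{2^{m−k}} − 1)`; `X_k := x_k ∈ ℚ̄₂`)

* §1 `zeta_two_two_inv`, `sprungEll_one` (`ℓ_1 = −2`), `sprungEll_two_add_smul` (`σζ_4 = ζ_4⁻¹ ⇒ ℓ_2 + σℓ_2 = −2 − 4X_1`), `sprungEll_three_add_smul`
  (`σζ_8 = ζ_8⁻¹ ⇒ ℓ_3 + σℓ_3 = (ζ_8 + ζ_8⁻¹) − 2 − 2X_1 − 4X_2`), `flatLog_zero_eq` (`N(ℓ_2+σℓ_2) − 2ℓ_1 = −2N(1 + 2X_1) + 4`),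
  `flatLog_one_add_smul_eq` (`X + g₀X = −N(4 + 4X_1 + 8X_2) + 8` for `X = N(ℓ_3+σℓ_3) − 2ℓ_1`, `g₀ζ_8 = ζ_8⁵`);
* §2 for the displayed system: `ptLogΩ_smul_flatHondaPoint_eq` (`Λ(T⁻¹(ρ • d_n)) = ρ • (N(ℓ_{n+2} + σ•ℓ_{n+2}) − 2ℓ_1)`),
  ★ `ptLogΩ_flatHondaPoint_zero` (`Λ(T⁻¹ d_0) = 2(a² − 2a − 1)`), ★ `ptLogΩ_flatHondaPoint_one_add_smul` (`Λ(T⁻¹ d_1) + Λ(T⁻¹(g₀ • d_1)) =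
  2(a³ − 2a² − 3a + 4)`), and the two in the pairing-sum enumeration: `sum_pow_mul_ptLogΩ_pow_smul_flatHondaPoint_eq_level_zero`,
  `sum_pow_mul_ptLogΩ_pow_smul_flatHondaPoint_eq_one_level_one` — E2's `hlog` with `ℓ₀ = 2h₀`, `h₀ = a²−2a−1` resp. `a³−2a²−3a+4`
  (matching FILE E2c's Hecke values `RTSS f 𝟙 = h₀·[0]⁺`).

References: [Kobayashi2003] S. Kobayashi, Invent. Math. 152 (2003), §8.4 (Lemma 8.9), Prop. 8.26; [Sprung2012] F. Sprung, J. Number Theory 132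
(2012), Thm. 2.2, Lemma 2.3; [KuriharaOtsuki2006] §1.3; [Washington1997] §13.1.
-/

set_option autoImplicit false
-- the Theorems namespace of this sub repeats the summit name by design (D-0017 nested layout)
set_option linter.dupNamespace false

noncomputable section

open scoped Classical IntermediateField Topology NNReal NumberField

namespace Summit.BirchSwinnertonDyer.BirchSwinnertonDyer.Theorems.SSFlatERL

open Field WeierstrassCurve NumberField IsDedekindDomain Literature.NumberTheory.EllipticCurves
  Literature.NumberTheory.GaloisRepresentations
  Literature.NumberTheory.EllipticCurves.ZpExtension Literature.NumberTheory.EllipticCurves.Kobayashi2003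
  Literature.NumberTheory.EllipticCurves.FormalGroupChart Literature.NumberTheory.EllipticCurves.Rank1Residual
  Summit.BirchSwinnertonDyer.Rank1Residual.Additive Summit.BirchSwinnertonDyer.Rank1Residual.Additive.PadicCyclotomicTower
  Summit.BirchSwinnertonDyer.Rank1Residual.Additive.BallEval
  Summit.BirchSwinnertonDyer.BirchSwinnertonDyer.Theorems.SignedKatoOffTwo.LocalTwo
  Summit.BirchSwinnertonDyer.BirchSwinnertonDyer.Theorems.SignedKatoOffTwo.HondaLog
  Summit.BirchSwinnertonDyer.BirchSwinnertonDyer.Theorems.SignedKatoOffTwo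
  Summit.BirchSwinnertonDyer.BirchSwinnertonDyer.Theorems.SignedEC.PlusLayer
  Summit.BirchSwinnertonDyer.BirchSwinnertonDyer.Theorems.SignedEC

/-! ## §1 The Sprung logarithm at the bottom of the `2`-adic tower -/

section Bottom

variable (x : ℕ → ℚ_[2])

/-- `ζ_4⁻¹ = −ζ_4`. [folklore] -/
theorem zeta_two_two_inv : (zeta 2 2)⁻¹ = -zeta 2 2 := by
  have hζ4 : IsPrimitiveRoot (zeta 2 2) (2 * 2) := by simpa using isPrimitiveRoot_zeta 2 2
  have hsq : zeta 2 2 ^ 2 = -1 := (hζ4.pow (by norm_num) rfl).eq_neg_one_of_two_right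
  refine inv_eq_of_mul_eq_one_right ?_
  linear_combination (-1 : PadicAlgCl 2) * hsq

/-- **`ℓ_1(x) = −2·x_0`**, i.e. `−2` for `x_0 = 1`. [cite: Sprung2012, Lemma 2.3] -/
theorem sprungEll_one (hx0 : x 0 = 1) :
    ∑ k ∈ Finset.range 1, algebraMap ℚ_[2] (PadicAlgCl 2) (x k) * (zeta 2 (1 - k) - 1) = -2 := by
  rw [Finset.sum_range_one, Nat.sub_zero, PlusTower.zeta_one, hx0, map_one]
  norm_num

/-- **`ℓ_2(x) + σ•ℓ_2(x) = −2 − 4x_1`** for an inverter `σ` of `ζ_4` (`ζ_4 + ζ_4⁻¹ = 0`, `ζ_2 = −1`, `x_0 = 1`). [cite: Sprung2012, Lemma 2.3] -/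
theorem sprungEll_two_add_smul (hx0 : x 0 = 1) {σ : Field.absoluteGaloisGroup ℚ_[2]} (hσ : σ • zeta 2 2 = (zeta 2 2)⁻¹) :
    (∑ k ∈ Finset.range 2, algebraMap ℚ_[2] (PadicAlgCl 2) (x k) * (zeta 2 (2 - k) - 1)) +
        σ • (∑ k ∈ Finset.range 2, algebraMap ℚ_[2] (PadicAlgCl 2) (x k) * (zeta 2 (2 - k) - 1)) =
      -2 - 4 * algebraMap ℚ_[2] (PadicAlgCl 2) (x 1) := by
  obtain ⟨a, -, -, ha⟩ := exists_smul_zeta_eq_pow σ 2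
  have hζ2a : zeta 2 2 ^ a = (zeta 2 2)⁻¹ := by rw [← ha, hσ]
  have hζ1a : zeta 2 1 ^ a = -1 := by
    have h : σ • zeta 2 1 = zeta 2 1 ^ a := by
      rw [← SprungHonda.zeta_pow_prime_pow (p := 2) 2 1, smul_pow', ha, ← pow_mul, ← pow_mul, mul_comm]
    rw [← h, PlusTower.zeta_one, smul_neg, Field.absoluteGaloisGroup.smul_def, map_one]
  rw [smul_sprungEll_eq_twisted x σ 2 ha]
  simp only [Finset.sum_range_succ, Finset.sum_range_zero, zero_add, Nat.sub_zero, show (2 - 1 : ℕ) = 1 from rfl,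
    hx0, map_one, one_mul, hζ2a, hζ1a]
  rw [zeta_two_two_inv, PlusTower.zeta_one]
  ring

/-- **`ℓ_3(x) + σ•ℓ_3(x) = (ζ_8 + ζ_8⁻¹) − 2 − 2x_1 − 4x_2`** for an inverter `σ` of `ζ_8` (then `σζ_4 = ζ_4⁻¹ = −ζ_4`).
[cite: Sprung2012, Lemma 2.3] [cite: Kobayashi2003, §8.4] -/
theorem sprungEll_three_add_smul (hx0 : x 0 = 1) {σ : Field.absoluteGaloisGroup ℚ_[2]} (hσ : σ • zeta 2 3 = (zeta 2 3)⁻¹) :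
    (∑ k ∈ Finset.range 3, algebraMap ℚ_[2] (PadicAlgCl 2) (x k) * (zeta 2 (3 - k) - 1)) +
        σ • (∑ k ∈ Finset.range 3, algebraMap ℚ_[2] (PadicAlgCl 2) (x k) * (zeta 2 (3 - k) - 1)) =
      (zeta 2 3 + (zeta 2 3)⁻¹) - 2 - 2 * algebraMap ℚ_[2] (PadicAlgCl 2) (x 1) - 4 * algebraMap ℚ_[2] (PadicAlgCl 2) (x 2) := by
  obtain ⟨a, -, -, ha⟩ := exists_smul_zeta_eq_pow σ 3
  have hσ2 : σ • zeta 2 2 = (zeta 2 2)⁻¹ := smul_zeta_eq_inv_of_le (by norm_num : 2 ≤ 3) hσ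
  have hζ2a : zeta 2 2 ^ a = (zeta 2 2)⁻¹ := by
    rw [← hσ2, ← SprungHonda.zeta_pow_prime_pow (p := 2) 3 1, smul_pow', ha, ← pow_mul, ← pow_mul, mul_comm]
  have hζ1a : zeta 2 1 ^ a = -1 := by
    have h : σ • zeta 2 1 = zeta 2 1 ^ a := by
      rw [← SprungHonda.zeta_pow_prime_pow (p := 2) 3 2, smul_pow', ha, ← pow_mul, ← pow_mul, mul_comm]
    rw [← h, PlusTower.zeta_one, smul_neg, Field.absoluteGaloisGroup.smul_def, map_one]
  have hζ3a : zeta 2 3 ^ a = (zeta 2 3)⁻¹ := by rw [← ha, hσ]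
  rw [smul_sprungEll_eq_twisted x σ 3 ha]
  simp only [Finset.sum_range_succ, Finset.sum_range_zero, zero_add, Nat.sub_zero, show (3 - 1 : ℕ) = 2 from rfl,
    show (3 - 2 : ℕ) = 1 from rfl, hx0, map_one, one_mul, hζ3a, hζ2a, hζ1a]
  rw [zeta_two_two_inv, PlusTower.zeta_one]
  ring

/-- **`n = 0`: `N(ℓ_2 + σℓ_2) − 2ℓ_1 = 4 − 2N(1 + 2x_1)`** for an inverter `σ` of `ζ_4`. [cite: KuriharaOtsuki2006, §1.3] [cite: Sprung2012, Lemma 2.3] -/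
theorem flatLog_zero_eq (hx0 : x 0 = 1) (N : ℕ) {σ : Field.absoluteGaloisGroup ℚ_[2]} (hσ : σ • zeta 2 2 = (zeta 2 2)⁻¹) :
    (N : PadicAlgCl 2) * ((∑ k ∈ Finset.range 2, algebraMap ℚ_[2] (PadicAlgCl 2) (x k) * (zeta 2 (2 - k) - 1)) +
          σ • (∑ k ∈ Finset.range 2, algebraMap ℚ_[2] (PadicAlgCl 2) (x k) * (zeta 2 (2 - k) - 1))) -
        2 * (∑ k ∈ Finset.range 1, algebraMap ℚ_[2] (PadicAlgCl 2) (x k) * (zeta 2 (1 - k) - 1)) =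
      4 - 2 * (N : PadicAlgCl 2) * (1 + 2 * algebraMap ℚ_[2] (PadicAlgCl 2) (x 1)) := by
  rw [sprungEll_two_add_smul x hx0 hσ, sprungEll_one x hx0]
  ring

/-- **`n = 1`: `X + g₀•X = 8 − N(4 + 4x_1 + 8x_2)`** for `X = N(ℓ_3 + σℓ_3) − 2ℓ_1`, `σζ_8 = ζ_8⁻¹`, `g₀ζ_8 = ζ_8⁵ = −ζ_8` (so `g₀` negates
`ζ_8 + ζ_8⁻¹` and fixes `ℚ₂`). [cite: Kobayashi2003, §8.4, Prop. 8.26] [cite: Sprung2012, Lemma 2.3] -/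
theorem flatLog_one_add_smul_eq (hx0 : x 0 = 1) (N : ℕ) {σ g₀ : Field.absoluteGaloisGroup ℚ_[2]} (hσ : σ • zeta 2 3 = (zeta 2 3)⁻¹)
    (hg₀ : g₀ • zeta 2 3 = zeta 2 3 ^ 5) :
    ((N : PadicAlgCl 2) * ((∑ k ∈ Finset.range 3, algebraMap ℚ_[2] (PadicAlgCl 2) (x k) * (zeta 2 (3 - k) - 1)) +
          σ • (∑ k ∈ Finset.range 3, algebraMap ℚ_[2] (PadicAlgCl 2) (x k) * (zeta 2 (3 - k) - 1))) -
        2 * (∑ k ∈ Finset.range 1, algebraMap ℚ_[2] (PadicAlgCl 2) (x k) * (zeta 2 (1 - k) - 1))) +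
      g₀ • ((N : PadicAlgCl 2) * ((∑ k ∈ Finset.range 3, algebraMap ℚ_[2] (PadicAlgCl 2) (x k) * (zeta 2 (3 - k) - 1)) +
          σ • (∑ k ∈ Finset.range 3, algebraMap ℚ_[2] (PadicAlgCl 2) (x k) * (zeta 2 (3 - k) - 1))) -
        2 * (∑ k ∈ Finset.range 1, algebraMap ℚ_[2] (PadicAlgCl 2) (x k) * (zeta 2 (1 - k) - 1))) =
      8 - (N : PadicAlgCl 2) * (4 + 4 * algebraMap ℚ_[2] (PadicAlgCl 2) (x 1) + 8 * algebraMap ℚ_[2] (PadicAlgCl 2) (x 2)) := by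
  have hζ4 : zeta 2 3 ^ 4 = -1 := by
    have h := zeta_add_pow 2 1 2
    rw [show (1 + 2 : ℕ) = 3 from rfl, show (2 ^ 2 : ℕ) = 4 from rfl] at h
    rw [h, PlusTower.zeta_one]
  have hζ0 : zeta 2 3 ≠ 0 := (isPrimitiveRoot_zeta 2 3).ne_zero (by norm_num)
  have h5 : zeta 2 3 ^ 5 = -zeta 2 3 := by
    rw [show (5 : ℕ) = 4 + 1 from rfl, pow_add, hζ4, pow_one, neg_one_mul]
  rw [sprungEll_three_add_smul x hx0 hσ, sprungEll_one x hx0]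
  have hN : g₀ • (N : PadicAlgCl 2) = N := by rw [Field.absoluteGaloisGroup.smul_def, map_natCast]
  have h2 : g₀ • (2 : PadicAlgCl 2) = 2 := by rw [Field.absoluteGaloisGroup.smul_def, map_ofNat]
  have h4 : g₀ • (4 : PadicAlgCl 2) = 4 := by rw [Field.absoluteGaloisGroup.smul_def, map_ofNat]
  have hX1 : g₀ • algebraMap ℚ_[2] (PadicAlgCl 2) (x 1) = algebraMap ℚ_[2] (PadicAlgCl 2) (x 1) := by
    rw [Field.absoluteGaloisGroup.smul_def, AlgEquiv.commutes]
  have hX2 : g₀ • algebraMap ℚ_[2] (PadicAlgCl 2) (x 2) = algebraMap ℚ_[2] (PadicAlgCl 2) (x 2) := by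
    rw [Field.absoluteGaloisGroup.smul_def, AlgEquiv.commutes]
  rw [smul_sub, smul_mul', hN, smul_sub, smul_sub, smul_sub, smul_add, smul_inv'', hg₀, h5, h2, inv_neg, smul_mul', smul_mul', h2, h4,
    hX1, hX2, smul_mul', h2, smul_neg, h2]
  ring

end Bottom

/-! ## §2 The base-case logarithms of the displayed Sprung–Honda point -/

section Base

variable (W : WeierstrassCurve ℚ) [W.IsElliptic] [W.IsGloballyMinimal]
  {x : ℕ → ℚ_[2]} {y : ℕ → localPoints W ℚ_[2]} {σ : ℕ → Field.absoluteGaloisGroup ℚ_[2]} {d : ℕ → localPoints W ℚ_[2]} {N : ℕ}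

/-- **`Λ(T⁻¹(ρ • d_n)) = ρ • (N(ℓ_{n+2} + σ_{n+2}•ℓ_{n+2}) − 2ℓ_1)`** for the displayed Sprung–Honda data and every `ρ ∈ Γ_{ℚ₂}`
(FILE E1a's `ptLogΩ_act_flatPoint` for the transported action). [cite: Kobayashi2003, §8.4 (Lemma 8.9), Prop. 8.26] -/
theorem ptLogΩ_smul_flatHondaPoint_eq
    (hyΩ : haveI := isIntegral_genFib_baseChange 2 ((integralModelInt W).map (Int.castRingHom ℤ_[2]))
        ∀ m, (toLoc ((genFibΩ_eq_baseChange ((integralModelInt W).map (Int.castRingHom ℤ_[2]))).trans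
              (baseChange_twoAdicModel W))).symm (y m) ∈
            subfieldPoints (genFibΩ 2 ((integralModelInt W).map (Int.castRingHom ℤ_[2]))) (layer 2 m).toSubfield
              coeffs_mem_layer ∧
          (toLoc ((genFibΩ_eq_baseChange ((integralModelInt W).map (Int.castRingHom ℤ_[2]))).trans
              (baseChange_twoAdicModel W))).symm (y m) ∈
            kernel (Valued.v (R := PadicAlgCl 2)) (genFibΩ 2 ((integralModelInt W).map (Int.castRingHom ℤ_[2]))) ∧
          ptLogΩ 2 ((integralModelInt W).map (Int.castRingHom ℤ_[2]))
            ((toLoc ((genFibΩ_eq_baseChange ((integralModelInt W).map (Int.castRingHom ℤ_[2]))).trans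
              (baseChange_twoAdicModel W))).symm (y m)) =
            ∑ k ∈ Finset.range m, algebraMap ℚ_[2] (PadicAlgCl 2) (x k) * (zeta 2 (m - k) - 1))
    (hd : ∀ n, d n = N • (y (n + 2) + σ (n + 2) • y (n + 2)) - 2 • y 1)
    (n : ℕ) (ρ : Field.absoluteGaloisGroup ℚ_[2]) :
    haveI := isIntegral_genFib_baseChange 2 ((integralModelInt W).map (Int.castRingHom ℤ_[2]))
    ptLogΩ 2 ((integralModelInt W).map (Int.castRingHom ℤ_[2]))
        ((toLoc ((genFibΩ_eq_baseChange ((integralModelInt W).map (Int.castRingHom ℤ_[2]))).trans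
          (baseChange_twoAdicModel W))).symm (ρ • d n)) =
      ρ • ((N : PadicAlgCl 2) * ((∑ k ∈ Finset.range (n + 2), algebraMap ℚ_[2] (PadicAlgCl 2) (x k) * (zeta 2 (n + 2 - k) - 1)) +
            σ (n + 2) • ∑ k ∈ Finset.range (n + 2), algebraMap ℚ_[2] (PadicAlgCl 2) (x k) * (zeta 2 (n + 2 - k) - 1)) -
          2 * ∑ k ∈ Finset.range 1, algebraMap ℚ_[2] (PadicAlgCl 2) (x k) * (zeta 2 (1 - k) - 1)) := by
  set M : WeierstrassCurve ℤ_[2] := (integralModelInt W).map (Int.castRingHom ℤ_[2]) with hM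
  haveI := isElliptic_coe_twoAdicModel W
  haveI hintΩ := isIntegral_genFib_baseChange 2 M
  set hV := (genFibΩ_eq_baseChange M).trans (baseChange_twoAdicModel W) with hVdef
  set act : Field.absoluteGaloisGroup ℚ_[2] → (genFibΩ 2 M).toAffine.Point → (genFibΩ 2 M).toAffine.Point :=
    fun τ P ↦ (toLoc hV).symm (τ • toLoc hV P) with hact
  obtain ⟨hcL, hck, hcℓ⟩ := hyΩ (n + 2)
  obtain ⟨hc₁L, hc₁k, hc₁ℓ⟩ := hyΩ 1
  have hpt : (toLoc hV).symm (ρ • d n) =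
      act ρ (N • ((toLoc hV).symm (y (n + 2)) + act (σ (n + 2)) ((toLoc hV).symm (y (n + 2)))) -
        (2 : ℕ) • (toLoc hV).symm (y 1)) := by
    rw [hd n, hact]
    simp only [map_sub, map_nsmul, map_add, AddEquiv.apply_symm_apply]
  rw [hpt]
  exact ptLogΩ_act_flatPoint act (act_zero hV) (act_some hV) (σ (n + 2)) ρ N (by omega : 1 ≤ n + 2)
    hcL hck hcℓ hc₁L hc₁k hc₁ℓ

/-- **`Λ(T⁻¹(d_0)) = 2(a² − 2a − 1)`** for the displayed Sprung–Honda system (`2x_1 = a`, `N = 3 − a`): `N(ℓ_2+σℓ_2) − 2ℓ_1 = 4 − 2N(1 + a)`.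
[cite: Sprung2012, Thm. 2.2, Lemma 2.3] [cite: KuriharaOtsuki2006, §1.3] -/
theorem ptLogΩ_flatHondaPoint_zero (hx0 : x 0 = 1) {a : ℤ} (hx1 : (2 : ℚ_[2]) * x 1 = a) (hN : (N : ℤ) = 3 - a)
    (hyΩ : haveI := isIntegral_genFib_baseChange 2 ((integralModelInt W).map (Int.castRingHom ℤ_[2]))
        ∀ m, (toLoc ((genFibΩ_eq_baseChange ((integralModelInt W).map (Int.castRingHom ℤ_[2]))).trans
              (baseChange_twoAdicModel W))).symm (y m) ∈
            subfieldPoints (genFibΩ 2 ((integralModelInt W).map (Int.castRingHom ℤ_[2]))) (layer 2 m).toSubfield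
              coeffs_mem_layer ∧
          (toLoc ((genFibΩ_eq_baseChange ((integralModelInt W).map (Int.castRingHom ℤ_[2]))).trans
              (baseChange_twoAdicModel W))).symm (y m) ∈
            kernel (Valued.v (R := PadicAlgCl 2)) (genFibΩ 2 ((integralModelInt W).map (Int.castRingHom ℤ_[2]))) ∧
          ptLogΩ 2 ((integralModelInt W).map (Int.castRingHom ℤ_[2]))
            ((toLoc ((genFibΩ_eq_baseChange ((integralModelInt W).map (Int.castRingHom ℤ_[2]))).trans
              (baseChange_twoAdicModel W))).symm (y m)) =
            ∑ k ∈ Finset.range m, algebraMap ℚ_[2] (PadicAlgCl 2) (x k) * (zeta 2 (m - k) - 1))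
    (hσ : ∀ m, 1 ≤ m → σ m • zeta 2 m = (zeta 2 m)⁻¹)
    (hd : ∀ n, d n = N • (y (n + 2) + σ (n + 2) • y (n + 2)) - 2 • y 1) :
    haveI := isIntegral_genFib_baseChange 2 ((integralModelInt W).map (Int.castRingHom ℤ_[2]))
    ptLogΩ 2 ((integralModelInt W).map (Int.castRingHom ℤ_[2]))
        ((toLoc ((genFibΩ_eq_baseChange ((integralModelInt W).map (Int.castRingHom ℤ_[2]))).trans
          (baseChange_twoAdicModel W))).symm (d 0)) = ((2 * ((a : ℚ) ^ 2 - 2 * a - 1) : ℚ) : PadicAlgCl 2) := by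
  have h := ptLogΩ_smul_flatHondaPoint_eq W hyΩ hd 0 1
  rw [one_smul, one_smul] at h
  rw [h, flatLog_zero_eq x hx0 N (hσ 2 (by norm_num))]
  have hx1' : 2 * algebraMap ℚ_[2] (PadicAlgCl 2) (x 1) = (a : PadicAlgCl 2) := by
    rw [← map_ofNat (algebraMap ℚ_[2] (PadicAlgCl 2)) 2, ← map_mul, hx1, map_intCast]
  have hN' : (N : PadicAlgCl 2) = 3 - (a : PadicAlgCl 2) := by exact_mod_cast hN
  rw [hx1', hN']
  push_cast
  ring

/-- **`Λ(T⁻¹(d_1)) + Λ(T⁻¹(g₀ • d_1)) = 2(a³ − 2a² − 3a + 4)`** for the displayed Sprung–Honda system (`2x_1 = a`, `2x_2 = a x_1 − x_0`,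
`N = 3 − a`) and any `g₀` with `g₀ζ_8 = ζ_8⁵`. [cite: Sprung2012, Thm. 2.2, Lemma 2.3] [cite: Kobayashi2003, §8.4, Prop. 8.26] -/
theorem ptLogΩ_flatHondaPoint_one_add_smul (hx0 : x 0 = 1) {a : ℤ} (hx1 : (2 : ℚ_[2]) * x 1 = a)
    (hx2 : (2 : ℚ_[2]) * x 2 = a * x 1 - x 0) (hN : (N : ℤ) = 3 - a)
    (hyΩ : haveI := isIntegral_genFib_baseChange 2 ((integralModelInt W).map (Int.castRingHom ℤ_[2]))
        ∀ m, (toLoc ((genFibΩ_eq_baseChange ((integralModelInt W).map (Int.castRingHom ℤ_[2]))).trans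
              (baseChange_twoAdicModel W))).symm (y m) ∈
            subfieldPoints (genFibΩ 2 ((integralModelInt W).map (Int.castRingHom ℤ_[2]))) (layer 2 m).toSubfield
              coeffs_mem_layer ∧
          (toLoc ((genFibΩ_eq_baseChange ((integralModelInt W).map (Int.castRingHom ℤ_[2]))).trans
              (baseChange_twoAdicModel W))).symm (y m) ∈
            kernel (Valued.v (R := PadicAlgCl 2)) (genFibΩ 2 ((integralModelInt W).map (Int.castRingHom ℤ_[2]))) ∧
          ptLogΩ 2 ((integralModelInt W).map (Int.castRingHom ℤ_[2]))
            ((toLoc ((genFibΩ_eq_baseChange ((integralModelInt W).map (Int.castRingHom ℤ_[2]))).trans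
              (baseChange_twoAdicModel W))).symm (y m)) =
            ∑ k ∈ Finset.range m, algebraMap ℚ_[2] (PadicAlgCl 2) (x k) * (zeta 2 (m - k) - 1))
    (hσ : ∀ m, 1 ≤ m → σ m • zeta 2 m = (zeta 2 m)⁻¹)
    (hd : ∀ n, d n = N • (y (n + 2) + σ (n + 2) • y (n + 2)) - 2 • y 1)
    {g₀ : Field.absoluteGaloisGroup ℚ_[2]} (hg₀ : g₀ • zeta 2 3 = zeta 2 3 ^ 5) :
    haveI := isIntegral_genFib_baseChange 2 ((integralModelInt W).map (Int.castRingHom ℤ_[2]))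
    ptLogΩ 2 ((integralModelInt W).map (Int.castRingHom ℤ_[2]))
        ((toLoc ((genFibΩ_eq_baseChange ((integralModelInt W).map (Int.castRingHom ℤ_[2]))).trans
          (baseChange_twoAdicModel W))).symm (d 1)) +
      ptLogΩ 2 ((integralModelInt W).map (Int.castRingHom ℤ_[2]))
        ((toLoc ((genFibΩ_eq_baseChange ((integralModelInt W).map (Int.castRingHom ℤ_[2]))).trans
          (baseChange_twoAdicModel W))).symm (g₀ • d 1)) = ((2 * ((a : ℚ) ^ 3 - 2 * a ^ 2 - 3 * a + 4) : ℚ) : PadicAlgCl 2) := by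
  have h1 := ptLogΩ_smul_flatHondaPoint_eq W hyΩ hd 1 1
  rw [one_smul, one_smul] at h1
  rw [h1, ptLogΩ_smul_flatHondaPoint_eq W hyΩ hd 1 g₀, flatLog_one_add_smul_eq x hx0 N (hσ 3 (by norm_num)) hg₀]
  have hx1' : 2 * algebraMap ℚ_[2] (PadicAlgCl 2) (x 1) = (a : PadicAlgCl 2) := by
    rw [← map_ofNat (algebraMap ℚ_[2] (PadicAlgCl 2)) 2, ← map_mul, hx1, map_intCast]
  have hx2' : 2 * algebraMap ℚ_[2] (PadicAlgCl 2) (x 2) = (a : PadicAlgCl 2) * algebraMap ℚ_[2] (PadicAlgCl 2) (x 1) - 1 := by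
    rw [← map_ofNat (algebraMap ℚ_[2] (PadicAlgCl 2)) 2, ← map_mul, hx2, hx0, map_sub, map_mul, map_intCast, map_one]
  have hN' : (N : PadicAlgCl 2) = 3 - (a : PadicAlgCl 2) := by exact_mod_cast hN
  have e4 : 4 * algebraMap ℚ_[2] (PadicAlgCl 2) (x 1) = 2 * (a : PadicAlgCl 2) := by rw [← hx1']; ring
  have e8 : 8 * algebraMap ℚ_[2] (PadicAlgCl 2) (x 2) = 2 * (a : PadicAlgCl 2) ^ 2 - 4 := by
    have h := hx2'
    calc 8 * algebraMap ℚ_[2] (PadicAlgCl 2) (x 2) = 4 * (2 * algebraMap ℚ_[2] (PadicAlgCl 2) (x 2)) := by ring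
      _ = 4 * ((a : PadicAlgCl 2) * algebraMap ℚ_[2] (PadicAlgCl 2) (x 1) - 1) := by rw [h]
      _ = 2 * (a : PadicAlgCl 2) * (2 * algebraMap ℚ_[2] (PadicAlgCl 2) (x 1)) - 4 := by ring
      _ = 2 * (a : PadicAlgCl 2) ^ 2 - 4 := by rw [hx1']; ring
  rw [e4, e8, hN']
  push_cast
  ring

/-- **Base case `n = 0` in the pairing-sum enumeration**: for EVERY Dirichlet character `χ` modulo `4`,
`Σ_{j<1} χ(5)ʲ · Λ(T⁻¹(g₀ʲ • d_0)) = 2(a² − 2a − 1)` (E2's `hlog` at `n = 0`, `ℓ₀ = 2h₀`, `h₀ = a² − 2a − 1`). [cite: Sprung2012, Thm. 2.2] -/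
theorem sum_pow_mul_ptLogΩ_pow_smul_flatHondaPoint_eq_level_zero (hx0 : x 0 = 1) {a : ℤ} (hx1 : (2 : ℚ_[2]) * x 1 = a)
    (hN : (N : ℤ) = 3 - a)
    (hyΩ : haveI := isIntegral_genFib_baseChange 2 ((integralModelInt W).map (Int.castRingHom ℤ_[2]))
        ∀ m, (toLoc ((genFibΩ_eq_baseChange ((integralModelInt W).map (Int.castRingHom ℤ_[2]))).trans
              (baseChange_twoAdicModel W))).symm (y m) ∈
            subfieldPoints (genFibΩ 2 ((integralModelInt W).map (Int.castRingHom ℤ_[2]))) (layer 2 m).toSubfield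
              coeffs_mem_layer ∧
          (toLoc ((genFibΩ_eq_baseChange ((integralModelInt W).map (Int.castRingHom ℤ_[2]))).trans
              (baseChange_twoAdicModel W))).symm (y m) ∈
            kernel (Valued.v (R := PadicAlgCl 2)) (genFibΩ 2 ((integralModelInt W).map (Int.castRingHom ℤ_[2]))) ∧
          ptLogΩ 2 ((integralModelInt W).map (Int.castRingHom ℤ_[2]))
            ((toLoc ((genFibΩ_eq_baseChange ((integralModelInt W).map (Int.castRingHom ℤ_[2]))).trans
              (baseChange_twoAdicModel W))).symm (y m)) =
            ∑ k ∈ Finset.range m, algebraMap ℚ_[2] (PadicAlgCl 2) (x k) * (zeta 2 (m - k) - 1))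
    (hσ : ∀ m, 1 ≤ m → σ m • zeta 2 m = (zeta 2 m)⁻¹)
    (hd : ∀ n, d n = N • (y (n + 2) + σ (n + 2) • y (n + 2)) - 2 • y 1)
    (g₀ : Field.absoluteGaloisGroup ℚ_[2]) (χ : DirichletCharacter (PadicAlgCl 2) (2 ^ (0 + 2))) :
    haveI := isIntegral_genFib_baseChange 2 ((integralModelInt W).map (Int.castRingHom ℤ_[2]))
    ∑ j ∈ Finset.range (2 ^ 0), χ (5 : ZMod (2 ^ (0 + 2))) ^ j *
        ptLogΩ 2 ((integralModelInt W).map (Int.castRingHom ℤ_[2]))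
          ((toLoc ((genFibΩ_eq_baseChange ((integralModelInt W).map (Int.castRingHom ℤ_[2]))).trans
            (baseChange_twoAdicModel W))).symm (g₀ ^ j • d 0)) = ((2 * ((a : ℚ) ^ 2 - 2 * a - 1) : ℚ) : PadicAlgCl 2) := by
  rw [pow_zero, Finset.sum_range_one, pow_zero, pow_zero, one_smul, one_mul]
  exact ptLogΩ_flatHondaPoint_zero W hx0 hx1 hN hyΩ hσ hd

/-- **Base case `n = 1`, trivial character, in the pairing-sum enumeration**: for `g₀ζ_8 = ζ_8⁵`,
`Σ_{j<2} 𝟙(5)ʲ · Λ(T⁻¹(g₀ʲ • d_1)) = 2(a³ − 2a² − 3a + 4)` (E2's `hlog` at `n = 1`, `h₀ = a³ − 2a² − 3a + 4`). [cite: Sprung2012, Thm. 2.2] -/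
theorem sum_pow_mul_ptLogΩ_pow_smul_flatHondaPoint_eq_one_level_one (hx0 : x 0 = 1) {a : ℤ} (hx1 : (2 : ℚ_[2]) * x 1 = a)
    (hx2 : (2 : ℚ_[2]) * x 2 = a * x 1 - x 0) (hN : (N : ℤ) = 3 - a)
    (hyΩ : haveI := isIntegral_genFib_baseChange 2 ((integralModelInt W).map (Int.castRingHom ℤ_[2]))
        ∀ m, (toLoc ((genFibΩ_eq_baseChange ((integralModelInt W).map (Int.castRingHom ℤ_[2]))).trans
              (baseChange_twoAdicModel W))).symm (y m) ∈
            subfieldPoints (genFibΩ 2 ((integralModelInt W).map (Int.castRingHom ℤ_[2]))) (layer 2 m).toSubfield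
              coeffs_mem_layer ∧
          (toLoc ((genFibΩ_eq_baseChange ((integralModelInt W).map (Int.castRingHom ℤ_[2]))).trans
              (baseChange_twoAdicModel W))).symm (y m) ∈
            kernel (Valued.v (R := PadicAlgCl 2)) (genFibΩ 2 ((integralModelInt W).map (Int.castRingHom ℤ_[2]))) ∧
          ptLogΩ 2 ((integralModelInt W).map (Int.castRingHom ℤ_[2]))
            ((toLoc ((genFibΩ_eq_baseChange ((integralModelInt W).map (Int.castRingHom ℤ_[2]))).trans
              (baseChange_twoAdicModel W))).symm (y m)) =
            ∑ k ∈ Finset.range m, algebraMap ℚ_[2] (PadicAlgCl 2) (x k) * (zeta 2 (m - k) - 1))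
    (hσ : ∀ m, 1 ≤ m → σ m • zeta 2 m = (zeta 2 m)⁻¹)
    (hd : ∀ n, d n = N • (y (n + 2) + σ (n + 2) • y (n + 2)) - 2 • y 1)
    {g₀ : Field.absoluteGaloisGroup ℚ_[2]} (hg₀ : g₀ • zeta 2 3 = zeta 2 3 ^ 5) :
    haveI := isIntegral_genFib_baseChange 2 ((integralModelInt W).map (Int.castRingHom ℤ_[2]))
    ∑ j ∈ Finset.range (2 ^ 1), (1 : DirichletCharacter (PadicAlgCl 2) (2 ^ (1 + 2))) (5 : ZMod (2 ^ (1 + 2))) ^ j *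
        ptLogΩ 2 ((integralModelInt W).map (Int.castRingHom ℤ_[2]))
          ((toLoc ((genFibΩ_eq_baseChange ((integralModelInt W).map (Int.castRingHom ℤ_[2]))).trans
            (baseChange_twoAdicModel W))).symm (g₀ ^ j • d 1)) =
      ((2 * ((a : ℚ) ^ 3 - 2 * a ^ 2 - 3 * a + 4) : ℚ) : PadicAlgCl 2) := by
  have h5 : (1 : DirichletCharacter (PadicAlgCl 2) (2 ^ (1 + 2))) (5 : ZMod (2 ^ (1 + 2))) = 1 := by
    refine MulChar.one_apply ?_
    exact (ZMod.isUnit_iff_coprime 5 (2 ^ (1 + 2))).mpr (by norm_num)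
  rw [h5, pow_one, Finset.sum_range_succ, Finset.sum_range_one, one_pow, one_pow, one_mul, one_mul, pow_zero, one_smul,
    pow_one]
  exact ptLogΩ_flatHondaPoint_one_add_smul W hx0 hx1 hx2 hN hyΩ hσ hd hg₀

end Base

end Summit.BirchSwinnertonDyer.BirchSwinnertonDyer.Theorems.SSFlatERL

end
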